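import Mathlib.Order.PiLex
import Literature.Computability.Complexity.SymmetricThresholdPrograms
import HarnessLib

/-!
# Symmetric threshold programs: the lex-min selection gadget

A reusable GADGET for symmetric threshold programs (`SymProg`, `SymmetricThresholdPrograms.lean`):
given, for every label `ℓ : L`, a flag wire `ok ℓ` and a vector of value wires `val ℓ : Fin N → _`,
the gadget outputs, at the wires `out p`, the value vector of a LEXICOGRAPHICALLY LEAST flagged label
(`LexMin.sem_out_eq`), and `false` everywhere if no label is flagged (`LexMin.sem_out_of_none`).
This is the top layer of every "canonical form = lex-min over all admissible labels" circuit
(symmetric canonisation of the window, route `PneNP/SymmetryBudget`, item `NoHiddenOrder`):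
flagged labels carry candidate canonical forms, any least one is THE canonical form, and the layer
is symmetric as soon as the labels are permuted among themselves (the output positions `p` are
fixed), which the user records as a `SymProg.IsSym` of the ambient program.

The gadget is presented as a STRUCTURE `SymProg.LexMin P L N` naming the gates of the ambient
program `P` that play each role, with the equations (kind, source set) they satisfy; instantiating
it costs one `rfl` per equation, after which the semantics is available:
`sem_eqv`, `sem_lt`, `sem_less` (strict lexicographic comparison of two value vectors, as
`toLex (V ℓ) < toLex (V ℓ')`), `sem_best` (flagged and not beaten), `sem_out`.
Gate count: `O(|L|²·N)`.

## References
* M. Anderson, A. Dawar, *On symmetric circuits and fixed-point logics*, Theory Comput. Syst. 60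
  (2017), §3 [AndersonDawar2016].
-/

namespace Literature.Computability.Complexity

open Finset

namespace SymProg

variable {ι Λ : Type*} [DecidableEq ι] [DecidableEq Λ] (P : SymProg ι Λ)
variable (L : Type*) [Fintype L] (N : ℕ)

/-- **The lex-min selection gadget** inside the program `P`, over labels `L` and `N` output
positions: the wires `ok ℓ`, `val ℓ p` it reads, the gates playing each role, and the equations
(kind and source set) these gates satisfy in `P`. [cite: AndersonDawar2016, §3] -/
structure LexMin where
  /-- flag wire of a label -/
  ok : L → ι ⊕ Λ
  /-- value wires of a label -/
  val : L → Fin N → ι ⊕ Λ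
  /-- `both ℓ ℓ' p`: both values at `p` are true -/
  both : L → L → Fin N → Λ
  /-- `none ℓ ℓ' p`: both values at `p` are false -/
  none : L → L → Fin N → Λ
  /-- `eqv ℓ ℓ' p`: the values at `p` agree -/
  eqv : L → L → Fin N → Λ
  /-- `nv ℓ p`: the value of `ℓ` at `p` is false -/
  nv : L → Fin N → Λ
  /-- `lt ℓ ℓ' p`: the vectors agree below `p`, and at `p` the value of `ℓ` is false, of `ℓ'` true -/
  lt : L → L → Fin N → Λ
  /-- `less ℓ ℓ'`: the vector of `ℓ` is lexicographically smaller -/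
  less : L → L → Λ
  /-- `win ℓ' ℓ`: `ℓ'` is flagged and beats `ℓ` -/
  win : L → L → Λ
  /-- `nb ℓ`: nobody beats `ℓ` -/
  nb : L → Λ
  /-- `best ℓ`: `ℓ` is flagged and nobody beats it -/
  best : L → Λ
  /-- `sel ℓ p`: `ℓ` is best and its value at `p` is true -/
  sel : L → Fin N → Λ
  /-- `out p`: the output at position `p` -/
  out : Fin N → Λ
  kind_both : ∀ ℓ ℓ' p, P.kind (both ℓ ℓ' p) = Kind.and
  srcs_both : ∀ ℓ ℓ' p, P.srcs (both ℓ ℓ' p) = {val ℓ p, val ℓ' p}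
  kind_none : ∀ ℓ ℓ' p, P.kind (none ℓ ℓ' p) = Kind.nor
  srcs_none : ∀ ℓ ℓ' p, P.srcs (none ℓ ℓ' p) = {val ℓ p, val ℓ' p}
  kind_eqv : ∀ ℓ ℓ' p, P.kind (eqv ℓ ℓ' p) = Kind.or
  srcs_eqv : ∀ ℓ ℓ' p, P.srcs (eqv ℓ ℓ' p) = {Sum.inr (both ℓ ℓ' p), Sum.inr (none ℓ ℓ' p)}
  kind_nv : ∀ ℓ p, P.kind (nv ℓ p) = Kind.nor
  srcs_nv : ∀ ℓ p, P.srcs (nv ℓ p) = {val ℓ p}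
  kind_lt : ∀ ℓ ℓ' p, P.kind (lt ℓ ℓ' p) = Kind.and
  srcs_lt : ∀ ℓ ℓ' p, P.srcs (lt ℓ ℓ' p) =
    (univ.filter fun q => q < p).image (fun q => Sum.inr (eqv ℓ ℓ' q)) ∪ {Sum.inr (nv ℓ p), val ℓ' p}
  kind_less : ∀ ℓ ℓ', P.kind (less ℓ ℓ') = Kind.or
  srcs_less : ∀ ℓ ℓ', P.srcs (less ℓ ℓ') = univ.image fun p => Sum.inr (lt ℓ ℓ' p)
  kind_win : ∀ ℓ' ℓ, P.kind (win ℓ' ℓ) = Kind.and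
  srcs_win : ∀ ℓ' ℓ, P.srcs (win ℓ' ℓ) = {ok ℓ', Sum.inr (less ℓ' ℓ)}
  kind_nb : ∀ ℓ, P.kind (nb ℓ) = Kind.nor
  srcs_nb : ∀ ℓ, P.srcs (nb ℓ) = univ.image fun ℓ' => Sum.inr (win ℓ' ℓ)
  kind_best : ∀ ℓ, P.kind (best ℓ) = Kind.and
  srcs_best : ∀ ℓ, P.srcs (best ℓ) = {ok ℓ, Sum.inr (nb ℓ)}
  kind_sel : ∀ ℓ p, P.kind (sel ℓ p) = Kind.and
  srcs_sel : ∀ ℓ p, P.srcs (sel ℓ p) = {Sum.inr (best ℓ), val ℓ p}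
  kind_out : ∀ p, P.kind (out p) = Kind.or
  srcs_out : ∀ p, P.srcs (out p) = univ.image fun ℓ => Sum.inr (sel ℓ p)

namespace LexMin

variable {P L N} (G : P.LexMin L N) (x : ι → Bool)

/-- The value vector of a label on input `x`. [folklore] -/
def V (ℓ : L) : Fin N → Bool := fun p => wval x (P.sem x) (G.val ℓ p)

/-- The flag of a label on input `x`. [folklore] -/
def Ok (ℓ : L) : Prop := wval x (P.sem x) (G.ok ℓ) = true

/-- `ℓ` is BEST: flagged, and no flagged label has a lexicographically smaller value vector. [folklore] -/
def IsBest (ℓ : L) : Prop := G.Ok x ℓ ∧ ∀ ℓ', G.Ok x ℓ' → ¬ toLex (G.V x ℓ') < toLex (G.V x ℓ)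

/-- Strict lexicographic comparison of vectors, unfolded. [folklore] -/
theorem toLex_lt_toLex_iff (a b : Fin N → Bool) :
    toLex a < toLex b ↔ ∃ i, (∀ j, j < i → a j = b j) ∧ a i < b i := Iff.rfl

/-- `both`. [folklore] -/
theorem sem_both (ℓ ℓ' : L) (p : Fin N) :
    P.sem x (G.both ℓ ℓ' p) = true ↔ G.V x ℓ p = true ∧ G.V x ℓ' p = true := by
  rw [P.sem_and (G.kind_both ℓ ℓ' p), G.srcs_both]
  simp only [mem_insert, mem_singleton, forall_eq_or_imp, forall_eq]
  rfl

/-- `none`. [folklore] -/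
theorem sem_none (ℓ ℓ' : L) (p : Fin N) :
    P.sem x (G.none ℓ ℓ' p) = true ↔ G.V x ℓ p = false ∧ G.V x ℓ' p = false := by
  rw [P.sem_nor (G.kind_none ℓ ℓ' p), G.srcs_none]
  simp only [mem_insert, mem_singleton, forall_eq_or_imp, forall_eq]
  rfl

/-- `eqv`: the values at `p` agree. [folklore] -/
theorem sem_eqv (ℓ ℓ' : L) (p : Fin N) :
    P.sem x (G.eqv ℓ ℓ' p) = true ↔ G.V x ℓ p = G.V x ℓ' p := by
  rw [P.sem_or (G.kind_eqv ℓ ℓ' p), G.srcs_eqv]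
  simp only [mem_insert, mem_singleton, exists_eq_or_imp, exists_eq_left, wval_inr, sem_both,
    sem_none]
  cases G.V x ℓ p <;> cases G.V x ℓ' p <;> simp

/-- `nv`: the value of `ℓ` at `p` is false. [folklore] -/
theorem sem_nv (ℓ : L) (p : Fin N) : P.sem x (G.nv ℓ p) = true ↔ G.V x ℓ p = false := by
  rw [P.sem_nor (G.kind_nv ℓ p), G.srcs_nv]
  simp only [mem_singleton, forall_eq]
  rfl

/-- `lt ℓ ℓ' p`: agreement below `p`, `false < true` at `p`. [folklore] -/
theorem sem_lt (ℓ ℓ' : L) (p : Fin N) :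
    P.sem x (G.lt ℓ ℓ' p) = true ↔
      (∀ q, q < p → G.V x ℓ q = G.V x ℓ' q) ∧ G.V x ℓ p = false ∧ G.V x ℓ' p = true := by
  rw [P.sem_and (G.kind_lt ℓ ℓ' p), G.srcs_lt]
  simp only [mem_union, mem_image, mem_filter, mem_univ, true_and, mem_insert, mem_singleton]
  constructor
  · intro h
    refine ⟨fun q hq => ?_, ?_, ?_⟩
    · have := h _ (Or.inl ⟨q, hq, rfl⟩)
      rwa [wval_inr, sem_eqv] at this
    · have := h _ (Or.inr (Or.inl rfl))
      rwa [wval_inr, sem_nv] at this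
    · exact h _ (Or.inr (Or.inr rfl))
  · rintro ⟨h1, h2, h3⟩ w (⟨q, hq, rfl⟩ | rfl | rfl)
    · rw [wval_inr, sem_eqv]; exact h1 q hq
    · rw [wval_inr, sem_nv]; exact h2
    · exact h3

/-- `less ℓ ℓ'`: **the value vector of `ℓ` is lexicographically smaller than that of `ℓ'`.** [folklore] -/
theorem sem_less (ℓ ℓ' : L) : P.sem x (G.less ℓ ℓ') = true ↔ toLex (G.V x ℓ) < toLex (G.V x ℓ') := by
  rw [P.sem_or (G.kind_less ℓ ℓ'), G.srcs_less, toLex_lt_toLex_iff]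
  simp only [mem_image, mem_univ, true_and, exists_exists_eq_and, wval_inr, sem_lt, Bool.lt_iff]

/-- `win ℓ' ℓ`: `ℓ'` is flagged and beats `ℓ`. [folklore] -/
theorem sem_win (ℓ' ℓ : L) :
    P.sem x (G.win ℓ' ℓ) = true ↔ G.Ok x ℓ' ∧ toLex (G.V x ℓ') < toLex (G.V x ℓ) := by
  rw [P.sem_and (G.kind_win ℓ' ℓ), G.srcs_win]
  simp only [mem_insert, mem_singleton, forall_eq_or_imp, forall_eq, wval_inr, sem_less]
  rfl

/-- `nb ℓ`: no flagged label beats `ℓ`. [folklore] -/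
theorem sem_nb (ℓ : L) :
    P.sem x (G.nb ℓ) = true ↔ ∀ ℓ', G.Ok x ℓ' → ¬ toLex (G.V x ℓ') < toLex (G.V x ℓ) := by
  rw [P.sem_nor (G.kind_nb ℓ), G.srcs_nb]
  simp only [mem_image, mem_univ, true_and, forall_exists_index, forall_apply_eq_imp_iff, wval_inr]
  refine forall_congr' fun ℓ' => ?_
  rw [← not_and, ← sem_win, Bool.not_eq_true]

/-- `best ℓ`: **`ℓ` is flagged and lexicographically least among the flagged labels.** [folklore] -/
theorem sem_best (ℓ : L) : P.sem x (G.best ℓ) = true ↔ G.IsBest x ℓ := by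
  rw [P.sem_and (G.kind_best ℓ), G.srcs_best]
  simp only [mem_insert, mem_singleton, forall_eq_or_imp, forall_eq, wval_inr, sem_nb]
  rfl

/-- `sel ℓ p`. [folklore] -/
theorem sem_sel (ℓ : L) (p : Fin N) :
    P.sem x (G.sel ℓ p) = true ↔ G.IsBest x ℓ ∧ G.V x ℓ p = true := by
  rw [P.sem_and (G.kind_sel ℓ p), G.srcs_sel]
  simp only [mem_insert, mem_singleton, forall_eq_or_imp, forall_eq, wval_inr, sem_best]
  rfl

/-- `out p`: some best label has value `true` at `p`. [folklore] -/
theorem sem_out (p : Fin N) : P.sem x (G.out p) = true ↔ ∃ ℓ, G.IsBest x ℓ ∧ G.V x ℓ p = true := by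
  rw [P.sem_or (G.kind_out p), G.srcs_out]
  simp only [mem_image, mem_univ, true_and, exists_exists_eq_and, wval_inr, sem_sel]

/-- Best labels have equal value vectors. [folklore] -/
theorem V_eq_of_isBest {ℓ ℓ' : L} (h : G.IsBest x ℓ) (h' : G.IsBest x ℓ') : G.V x ℓ = G.V x ℓ' := by
  have h1 : ¬ toLex (G.V x ℓ') < toLex (G.V x ℓ) := h.2 ℓ' h'.1
  have h2 : ¬ toLex (G.V x ℓ) < toLex (G.V x ℓ') := h'.2 ℓ h.1
  have : toLex (G.V x ℓ) = toLex (G.V x ℓ') := le_antisymm (not_lt.1 h1) (not_lt.1 h2)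
  exact toLex.injective this

/-- **A flagged label exists iff a best label exists.** [folklore] -/
theorem exists_isBest_iff : (∃ ℓ, G.IsBest x ℓ) ↔ ∃ ℓ, G.Ok x ℓ := by
  classical
  constructor
  · rintro ⟨ℓ, h⟩; exact ⟨ℓ, h.1⟩
  · rintro ⟨ℓ₀, h₀⟩
    obtain ⟨ℓ, hℓ, hmin⟩ := (univ.filter fun ℓ => G.Ok x ℓ).exists_min_image
      (fun ℓ => toLex (G.V x ℓ)) ⟨ℓ₀, mem_filter.2 ⟨mem_univ _, h₀⟩⟩
    refine ⟨ℓ, (mem_filter.1 hℓ).2, fun ℓ' h' => not_lt.2 (hmin ℓ' (mem_filter.2 ⟨mem_univ _, h'⟩))⟩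

/-- **The output is the value vector of any best label.** [folklore] -/
theorem sem_out_eq {ℓ : L} (h : G.IsBest x ℓ) (p : Fin N) : P.sem x (G.out p) = G.V x ℓ p := by
  rw [Bool.eq_iff_iff, sem_out]
  constructor
  · rintro ⟨ℓ', h', hv⟩; rw [G.V_eq_of_isBest x h h']; exact hv
  · intro hv; exact ⟨ℓ, h, hv⟩

/-- **The output is the value vector of a lexicographically least flagged label** (when some label is
flagged). [folklore] -/
theorem exists_sem_out_eq (hok : ∃ ℓ, G.Ok x ℓ) :
    ∃ ℓ, G.IsBest x ℓ ∧ ∀ p, P.sem x (G.out p) = G.V x ℓ p := by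
  obtain ⟨ℓ, h⟩ := (G.exists_isBest_iff x).2 hok
  exact ⟨ℓ, h, G.sem_out_eq x h⟩

/-- With no flagged label the output is identically `false`. [folklore] -/
theorem sem_out_of_none (hno : ∀ ℓ, ¬ G.Ok x ℓ) (p : Fin N) : P.sem x (G.out p) = false := by
  rw [← Bool.not_eq_true, sem_out]
  rintro ⟨ℓ, h, _⟩
  exact hno ℓ h.1

/-- **Canonicity.** If the flags and value vectors are invariant in the sense that a relabelling
`θ` of the labels carries flagged labels to flagged labels with the same value vector (as happens
for two inputs in the same orbit of a symmetric program, by `SymProg.sem_symm`), then the outputs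
agree. Stated for two inputs `x, y` and a bijection `θ` of labels. [folklore] -/
theorem sem_out_eq_of_relabel (y : ι → Bool) (θ : L ≃ L) (hok : ∀ ℓ, G.Ok x ℓ ↔ G.Ok y (θ ℓ))
    (hV : ∀ ℓ, G.Ok x ℓ → G.V x ℓ = G.V y (θ ℓ)) (p : Fin N) :
    P.sem x (G.out p) = P.sem y (G.out p) := by
  by_cases hx : ∃ ℓ, G.Ok x ℓ
  · obtain ⟨ℓ, hb, hout⟩ := G.exists_sem_out_eq x hx
    have hb' : G.IsBest y (θ ℓ) := by
      refine ⟨(hok ℓ).1 hb.1, fun m hm hlt => ?_⟩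
      have hm' : G.Ok x (θ.symm m) := by rw [hok, Equiv.apply_symm_apply]; exact hm
      refine hb.2 (θ.symm m) hm' ?_
      rw [hV _ hm', hV _ hb.1, Equiv.apply_symm_apply]
      exact hlt
    rw [hout p, G.sem_out_eq y hb' p, hV _ hb.1]
  · simp only [not_exists] at hx
    have hy : ∀ m, ¬ G.Ok y m := fun m hm => hx (θ.symm m) (by rw [hok, Equiv.apply_symm_apply]; exact hm)
    rw [G.sem_out_of_none x hx, G.sem_out_of_none y hy]

end LexMin

end SymProg

end Literature.Computability.Complexity
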